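import Summits.CriticalPhenomena.PercolationContinuityZ3.Theorems.PercNearOneGluingNoHeavyLowerTailSahiLatinHarris

/-!
# `NoHeavyLowerTail` (crux stmt-CriticalPhenomena-4575), Sahi programme (prim-master-conj gen 42): the one-, two- and three-particle
# LATIN FUNCTIONALS on `[3]^ι` and their elementary inequalities (exchangeability, Bonferroni, the empty-corner functional `E₁`,
# coefficientwise Harris in functional form, `κ` in functional form)

Support file (`--supports stmt-CriticalPhenomena-4575`; toolkit for the order-4 move lemmas `…SahiLatinMoves4`).  Memo
`run/shared/lean/prim/prim-l12/FROM-prim-master-conj-g41-DESCENT.md` §10 (Lemmas R₄/A₄ use exactly these facts on the link).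

With `(X,Y,Z)` the uniformly random Latin triple of `[3]^ι` (`6^d` of them, `L = |ι → Perm (Fin 3)|`), all as integer sums:
* `S1 s = #{X ∈ s}` (`= 2^d |s|`, `S1_eq`), `latinPairs s t = #{X∈s, Y∈t}` (from `…SahiLatinHarris`), `latinTriples s t v = #{X∈s,Y∈t,Z∈v}`;
* exchangeability: `sum_ind_one/two` (`#{Y∈s} = #{Z∈s} = S1 s`), `sum_pair02/12` (pairs on copies `(0,2)`, `(1,2)` = `latinPairs`);
* `S1_nonneg`, `S1_le_L`, `latinPairs_nonneg`, Bonferroni `S1_add_S1_le : S1 s + S1 t ≤ latinPairs s t + L`,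
  the empty-corner functional `E1_nonneg : 0 ≤ L − S1 b − S1 c − S1 d + latinPairs b c + latinPairs b d + latinPairs c d − latinTriples b c d`
  (`= #{X∉b, Y∉c, Z∉d}`);
* **`latinPairs_le_S1_inter`** (T1 in functional form): for up-sets, `#{X∈s, Y∈t} ≤ #{X ∈ s∩t}` (`= κ(Ω,s,t) ≥ 0`, `…SahiLatinHarris`);
* `kappa_eq_functionals : κ(s,t,v) = 2·S1(s∩t∩v) − latinPairs (t∩v) s − latinPairs (s∩v) t − latinPairs (s∩t) v + latinTriples s t v`.
Everything here is proved; axioms standard.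
-/

namespace Summit.CriticalPhenomena.PercolationContinuityZ3.Theorems.SahiLatin

open Finset

variable {ι : Type*} [Fintype ι] [DecidableEq ι]

/-- The number of Latin triples, `L = |ι → Perm (Fin 3)| = 6^d`, as an integer. [this work] -/
def Lnum (ι : Type*) [Fintype ι] [DecidableEq ι] : ℤ := Fintype.card (LPerm ι)

/-- One-particle functional `S1 s = #{Latin triples with X ∈ s}`. [this work] -/
def S1 (s : Finset (Pt ι)) : ℤ := ∑ σ : LPerm ι, ind s (lpt σ 0)

/-- Three-particle functional `#{Latin triples with X ∈ s, Y ∈ t, Z ∈ v}`. [this work] -/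
def latinTriples (s t v : Finset (Pt ι)) : ℤ := ∑ σ : LPerm ι, ind s (lpt σ 0) * ind t (lpt σ 1) * ind v (lpt σ 2)

/-- `ind` takes the values `0, 1`. [this work] -/
theorem ind_eq_zero_or_one {β : Type*} [DecidableEq β] (s : Finset β) (x : β) : ind s x = 0 ∨ ind s x = 1 := by
  by_cases h : x ∈ s
  · exact Or.inr (ind_of_mem h)
  · exact Or.inl (ind_of_not_mem h)

/-- `0 ≤ ind`. [this work] -/
theorem ind_nonneg {β : Type*} [DecidableEq β] (s : Finset β) (x : β) : 0 ≤ ind s x := by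
  rcases ind_eq_zero_or_one s x with h | h <;> simp [h]

/-- `ind ≤ 1`. [this work] -/
theorem ind_le_one {β : Type*} [DecidableEq β] (s : Finset β) (x : β) : ind s x ≤ 1 := by
  rcases ind_eq_zero_or_one s x with h | h <;> simp [h]

/-! ## Exchangeability -/

/-- `#{Y ∈ s} = S1 s`. [this work] -/
theorem sum_ind_one (s : Finset (Pt ι)) : ∑ σ : LPerm ι, ind s (lpt σ 1) = S1 s := by
  rw [S1, ← sum_lpt_swap01 (fun _ y _ => ind s y)]

/-- `#{Z ∈ s} = S1 s`. [this work] -/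
theorem sum_ind_two (s : Finset (Pt ι)) : ∑ σ : LPerm ι, ind s (lpt σ 2) = S1 s := by
  rw [← sum_ind_one s, ← sum_lpt_swap12 (fun _ _ z => ind s z)]

/-- Pairs on copies `(0,2)`: `#{X ∈ s, Z ∈ t} = latinPairs s t`. [this work] -/
theorem sum_pair02 (s t : Finset (Pt ι)) : ∑ σ : LPerm ι, ind s (lpt σ 0) * ind t (lpt σ 2) = latinPairs s t := by
  rw [latinPairs, ← sum_lpt_swap12 (fun x _ z => ind s x * ind t z)]

/-- Pairs on copies `(1,2)`: `#{Y ∈ s, Z ∈ t} = latinPairs s t`. [this work] -/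
theorem sum_pair12 (s t : Finset (Pt ι)) : ∑ σ : LPerm ι, ind s (lpt σ 1) * ind t (lpt σ 2) = latinPairs s t := by
  rw [← sum_pair02 s t, ← sum_lpt_swap01 (fun _ y z => ind s y * ind t z)]

/-! ## Elementary bounds -/

/-- `S1 s = 2^d |s|`. [this work] -/
theorem S1_eq (s : Finset (Pt ι)) : S1 s = 2 ^ Fintype.card ι * s.card := by
  rw [← sum_N s, ← sum_ind_one s, sum_lperm_eq_sum_link (fun _ y _ => ind s y)]
  refine sum_congr rfl fun u _ => ?_
  rw [N, natCast_card_filter]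
  exact sum_congr rfl fun y _ => by rw [ind_apply]

/-- `0 ≤ S1 s`. [this work] -/
theorem S1_nonneg (s : Finset (Pt ι)) : 0 ≤ S1 s := sum_nonneg fun _ _ => ind_nonneg _ _

/-- `S1 s ≤ L`. [this work] -/
theorem S1_le_L (s : Finset (Pt ι)) : S1 s ≤ Lnum ι := by
  have hL : Lnum ι = ∑ _σ : LPerm ι, (1 : ℤ) := by simp [Lnum]
  rw [hL, S1]
  exact sum_le_sum fun _ _ => ind_le_one _ _

/-- `0 ≤ latinPairs s t`. [this work] -/
theorem latinPairs_nonneg (s t : Finset (Pt ι)) : 0 ≤ latinPairs s t :=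
  sum_nonneg fun _ _ => mul_nonneg (ind_nonneg _ _) (ind_nonneg _ _)

/-- `0 ≤ latinTriples s t v`. [this work] -/
theorem latinTriples_nonneg (s t v : Finset (Pt ι)) : 0 ≤ latinTriples s t v :=
  sum_nonneg fun _ _ => mul_nonneg (mul_nonneg (ind_nonneg _ _) (ind_nonneg _ _)) (ind_nonneg _ _)

/-- **Bonferroni**: `S1 s + S1 t ≤ latinPairs s t + L` (`P(X∈s) + P(Y∈t) − 1 ≤ P(X∈s, Y∈t)`). [this work] -/
theorem S1_add_S1_le (s t : Finset (Pt ι)) : S1 s + S1 t ≤ latinPairs s t + Lnum ι := by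
  have hL : Lnum ι = ∑ _σ : LPerm ι, (1 : ℤ) := by simp [Lnum]
  rw [S1, ← sum_ind_one t, latinPairs, hL, ← sum_add_distrib, ← sum_add_distrib]
  refine sum_le_sum fun σ _ => ?_
  rcases ind_eq_zero_or_one s (lpt σ 0) with h | h <;> rcases ind_eq_zero_or_one t (lpt σ 1) with h' | h' <;> simp [h, h']

/-- **The empty-corner functional**: `0 ≤ L − S1 b − S1 c − S1 d + latinPairs b c + latinPairs b d + latinPairs c d − latinTriples b c d`
(it equals `#{X ∉ b, Y ∉ c, Z ∉ d}`). [this work] -/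
theorem E1_nonneg (b c d : Finset (Pt ι)) :
    0 ≤ Lnum ι - S1 b - S1 c - S1 d + latinPairs b c + latinPairs b d + latinPairs c d - latinTriples b c d := by
  have hL : Lnum ι = ∑ _σ : LPerm ι, (1 : ℤ) := by simp [Lnum]
  have key : Lnum ι - S1 b - S1 c - S1 d + latinPairs b c + latinPairs b d + latinPairs c d - latinTriples b c d =
      ∑ σ : LPerm ι, (1 - ind b (lpt σ 0)) * (1 - ind c (lpt σ 1)) * (1 - ind d (lpt σ 2)) := by
    rw [hL, S1, ← sum_ind_one c, ← sum_ind_two d, latinPairs, ← sum_pair02 b d, ← sum_pair12 c d, latinTriples]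
    simp only [← sum_sub_distrib, ← sum_add_distrib]
    exact sum_congr rfl fun σ _ => by ring
  rw [key]
  exact sum_nonneg fun σ _ => mul_nonneg (mul_nonneg (by linarith [ind_le_one b (lpt σ 0)]) (by linarith [ind_le_one c (lpt σ 1)]))
    (by linarith [ind_le_one d (lpt σ 2)])

/-- **T1 in functional form**: for up-sets `s, t`, `latinPairs s t ≤ S1 (s ∩ t)`. [this work] -/
theorem latinPairs_le_S1_inter {s t : Finset (Pt ι)} (hs : IsUpperSet (s : Set (Pt ι))) (ht : IsUpperSet (t : Set (Pt ι))) :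
    latinPairs s t ≤ S1 (s ∩ t) := by
  have h := kappa_univ_nonneg hs ht
  rw [kappa_univ, sum_sub_distrib, sum_N, sum_Lam] at h
  rw [S1_eq]
  linarith

/-- **`κ` in functional form**: `κ(s,t,v) = 2·S1(s∩t∩v) − latinPairs (t∩v) s − latinPairs (s∩v) t − latinPairs (s∩t) v + latinTriples s t v`.
[this work] -/
theorem kappa_eq_functionals (s t v : Finset (Pt ι)) :
    kappa s t v = 2 * S1 (s ∩ t ∩ v) - latinPairs (t ∩ v) s - latinPairs (s ∩ v) t - latinPairs (s ∩ t) v + latinTriples s t v := by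
  rw [latinPairs_comm (t ∩ v) s, latinPairs_comm (s ∩ v) t, latinPairs_comm (s ∩ t) v]
  unfold kappa S1 latinPairs latinTriples
  simp only [G, ind_inter, mul_sum, ← sum_sub_distrib, ← sum_add_distrib]

end Summit.CriticalPhenomena.PercolationContinuityZ3.Theorems.SahiLatin
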